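import Mathlib
import Summits.NavierStokesRegularity.NavierStokesRegularity.Theorems.FilamentSkeletonRssDefectColumnGateAzimuthalBlockLayer
import Summits.NavierStokesRegularity.NavierStokesRegularity.Theorems.FilamentSkeletonRssDefectColumnGateAzimuthalBlockTools

/-!
# Route `FilamentSkeletonRss` · crux `TransverseReduction1AG` (stmt-NavierStokesRegularity-27853; A1L twin stmt-23297) · line
# `defect_column_gate_1AG/1AL` — the LAYER CHOICE of the truncation radius for the two-zone scheme of the azimuthal blocks of S2a-loc
# `WaistColumnGateLoc1A`: a point `u₁ ∈ [u₀ + 1/γ, u₀ + 2/γ]` at which BOTH Gaussian boundary fluxes are controlled by Gaussian-weighted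
# layer integrals of the modulus and of the forcing pairing only (stage 2 of the assembly)

Helper file (`--supports stmt-NavierStokesRegularity-27853 --as helper`; seat ns-filament-s2aloc-p1 g2; note ARCHITECTURE-B2B3-s2aloc-g2.md v3 §7/§7b).
Combines `exists_mul_le_integral` (`…Tools.lean`) with `layer_dissipation_le` (`…Layer.lean`, χ²-cut-off on `L′ = [u₀, u₀ + 3/γ]`, where
`χ = (u − u₀)(u₀ + 3/γ − u)` satisfies `χ² ≥ γ⁻⁴` on the middle third, `χ² ≤ 81/(16γ⁴)`, `χ′² ≤ 9/γ²` on `L′`).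

`layer_flux_choice`:  there is `u₁ ∈ [u₀ + 1/γ, u₀ + 2/γ]` with
`|B₁(u₁)| + |B₂(u₁)| ≤ 4γ·[(1 + 36γ²)∫_{L′} E u (a²+b²) + (81γ/32)∫_{L′} E (a²+b²) + (81/32)∫_{L′} E |a f₁ + b f₂|]`,
`B₁ = E(aΦ_b − bΦ_a)` (rotation flux), `B₂ = E(aΦ_a + bΦ_b − γu(a²+b²))` (modulus flux), `E = e^{γu/4}`, for the mode system with ANY `V`, `f`
(the caller folds the Biot–Savart term into `f`).  In the scheme `L′` lies in the V-blind exterior zone, so every right-hand term is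
`≤ E(u₀+3/γ)·poly(u₀)·(exterior sup)` or a forcing pairing.
HONEST FRAMING: an elementary selection lemma for ONE family of blocks of ONE linear MODEL operator of a hypothetical blow-up route (MODEL rung,
negative side); nothing here bears on NS regularity.
-/

set_option linter.dupNamespace false

noncomputable section

namespace Summit.NavierStokesRegularity.NavierStokesRegularity.Theorems.DefectColumnGate

open scoped Topology
open Set Filter MeasureTheory intervalIntegral

set_option maxHeartbeats 1600000 in
/-- **Layer choice of the truncation radius.**  `γ > 0`, `u₀ > 0`; on `L′ = [u₀, u₀ + 3/γ]`: `a, b, a₁, b₁, f₁, f₂` continuous, `a′ = a₁`,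
`b′ = b₁`, and the mode fluxes `(4u a₁ + γu a)′ = (m²/u)a − V b − f₁`, `(4u b₁ + γu b)′ = (m²/u)b + V a − f₂` on the interior (any `V`).  Then some
`u₁ ∈ [u₀ + 1/γ, u₀ + 2/γ]` satisfies the displayed bound of the module docstring. -/
theorem layer_flux_choice {γ m u₀ : ℝ} {a a₁ b b₁ f₁ f₂ V : ℝ → ℝ} (hγ : 0 < γ) (hu₀ : 0 < u₀)
    (ha : ContinuousOn a (Icc u₀ (u₀ + 3 / γ))) (hb : ContinuousOn b (Icc u₀ (u₀ + 3 / γ)))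
    (ha₁ : ContinuousOn a₁ (Icc u₀ (u₀ + 3 / γ))) (hb₁ : ContinuousOn b₁ (Icc u₀ (u₀ + 3 / γ)))
    (hf₁ : ContinuousOn f₁ (Icc u₀ (u₀ + 3 / γ))) (hf₂ : ContinuousOn f₂ (Icc u₀ (u₀ + 3 / γ)))
    (hdera : ∀ u ∈ Ioo u₀ (u₀ + 3 / γ), HasDerivAt a (a₁ u) u) (hderb : ∀ u ∈ Ioo u₀ (u₀ + 3 / γ), HasDerivAt b (b₁ u) u)
    (hΦa : ∀ u ∈ Ioo u₀ (u₀ + 3 / γ),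
      HasDerivAt (fun s => 4 * s * a₁ s + γ * s * a s) (m ^ 2 / u * a u - V u * b u - f₁ u) u)
    (hΦb : ∀ u ∈ Ioo u₀ (u₀ + 3 / γ),
      HasDerivAt (fun s => 4 * s * b₁ s + γ * s * b s) (m ^ 2 / u * b u + V u * a u - f₂ u) u) :
    ∃ u₁ ∈ Icc (u₀ + 1 / γ) (u₀ + 2 / γ),
      |Real.exp (γ * u₁ / 4) * (a u₁ * (4 * u₁ * b₁ u₁ + γ * u₁ * b u₁) - b u₁ * (4 * u₁ * a₁ u₁ + γ * u₁ * a u₁))|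
        + |Real.exp (γ * u₁ / 4) * (a u₁ * (4 * u₁ * a₁ u₁ + γ * u₁ * a u₁) + b u₁ * (4 * u₁ * b₁ u₁ + γ * u₁ * b u₁)
            - γ * u₁ * (a u₁ ^ 2 + b u₁ ^ 2))|
      ≤ 4 * γ * ((1 + 36 * γ ^ 2) * (∫ u in u₀..(u₀ + 3 / γ), Real.exp (γ * u / 4) * (u * (a u ^ 2 + b u ^ 2)))
          + 81 * γ / 32 * (∫ u in u₀..(u₀ + 3 / γ), Real.exp (γ * u / 4) * (a u ^ 2 + b u ^ 2))
          + 81 / 32 * (∫ u in u₀..(u₀ + 3 / γ), Real.exp (γ * u / 4) * |a u * f₁ u + b u * f₂ u|)) := by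
  -- the layer `L = [p, q]` (middle third of `L' = [u₀, r]`)
  set p : ℝ := u₀ + 1 / γ with hpdef
  set q : ℝ := u₀ + 2 / γ with hqdef
  set r : ℝ := u₀ + 3 / γ with hrdef
  have hℓ : 0 < 1 / γ := by positivity
  have hp0 : 0 < p := by rw [hpdef]; positivity
  have h2γ : 2 / γ = 2 * (1 / γ) := by ring
  have h3γ : 3 / γ = 3 * (1 / γ) := by ring
  have hpq : p ≤ q := by rw [hpdef, hqdef]; linarith
  have hpq' : q - p = 1 / γ := by rw [hpdef, hqdef]; ring
  have hu₀p : u₀ ≤ p := by rw [hpdef]; linarith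
  have hqr : q ≤ r := by rw [hqdef, hrdef]; linarith
  have hu₀r : u₀ ≤ r := le_trans hu₀p (hpq.trans hqr)
  have hsubL : Icc p q ⊆ Icc u₀ r := Icc_subset_Icc hu₀p hqr
  set E : ℝ → ℝ := fun u => Real.exp (γ * u / 4) with hEdef
  set s : ℝ → ℝ := fun u => a u ^ 2 + b u ^ 2 with hsdef
  set w2 : ℝ → ℝ := fun u => a₁ u ^ 2 + b₁ u ^ 2 with hw2def
  -- the function to minimise on `L`
  set G : ℝ → ℝ := fun u => E u * u * (s u + w2 u) with hGdef
  have hEc : ContinuousOn E (Icc u₀ r) := (Real.continuous_exp.comp (by continuity)).continuousOn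
  have hsc : ContinuousOn s (Icc u₀ r) := (ha.pow 2).add (hb.pow 2)
  have hw2c : ContinuousOn w2 (Icc u₀ r) := (ha₁.pow 2).add (hb₁.pow 2)
  have hGc : ContinuousOn G (Icc p q) := ((hEc.mono hsubL).mul continuousOn_id).mul ((hsc.mono hsubL).add (hw2c.mono hsubL))
  obtain ⟨u₁, hu₁, hGu₁⟩ := exists_mul_le_integral hpq hGc
  refine ⟨u₁, by simpa [hpdef, hqdef] using hu₁, ?_⟩
  have hu₁0 : 0 < u₁ := lt_of_lt_of_le hp0 hu₁.1
  have hE0 : 0 < E u₁ := Real.exp_pos _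
  -- pointwise: both fluxes are `≤ 2 G(u₁)`
  have hflux : |E u₁ * (a u₁ * (4 * u₁ * b₁ u₁ + γ * u₁ * b u₁) - b u₁ * (4 * u₁ * a₁ u₁ + γ * u₁ * a u₁))|
      + |E u₁ * (a u₁ * (4 * u₁ * a₁ u₁ + γ * u₁ * a u₁) + b u₁ * (4 * u₁ * b₁ u₁ + γ * u₁ * b u₁) - γ * u₁ * s u₁)|
      ≤ 4 * G u₁ := by
    have e1 : E u₁ * (a u₁ * (4 * u₁ * b₁ u₁ + γ * u₁ * b u₁) - b u₁ * (4 * u₁ * a₁ u₁ + γ * u₁ * a u₁))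
        = 4 * (E u₁ * u₁) * (a u₁ * b₁ u₁ - b u₁ * a₁ u₁) := by ring
    have e2 : E u₁ * (a u₁ * (4 * u₁ * a₁ u₁ + γ * u₁ * a u₁) + b u₁ * (4 * u₁ * b₁ u₁ + γ * u₁ * b u₁) - γ * u₁ * s u₁)
        = 4 * (E u₁ * u₁) * (a u₁ * a₁ u₁ + b u₁ * b₁ u₁) := by simp only [hsdef]; ring
    have h4pos : (0:ℝ) < 4 * (E u₁ * u₁) := by positivity
    have hab1 : |4 * (E u₁ * u₁) * (a u₁ * b₁ u₁ - b u₁ * a₁ u₁)| = 4 * (E u₁ * u₁) * |a u₁ * b₁ u₁ - b u₁ * a₁ u₁| := by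
      rw [abs_mul, abs_of_pos h4pos]
    have hab2 : |4 * (E u₁ * u₁) * (a u₁ * a₁ u₁ + b u₁ * b₁ u₁)| = 4 * (E u₁ * u₁) * |a u₁ * a₁ u₁ + b u₁ * b₁ u₁| := by
      rw [abs_mul, abs_of_pos h4pos]
    rw [e1, e2, hab1, hab2]
    have hEu : 0 ≤ E u₁ * u₁ := by positivity
    have k1 : |a u₁ * b₁ u₁ - b u₁ * a₁ u₁| ≤ (s u₁ + w2 u₁) / 2 := by
      rw [abs_le]; simp only [hsdef, hw2def]
      constructor
      · nlinarith [sq_nonneg (a u₁ + b₁ u₁), sq_nonneg (b u₁ - a₁ u₁)]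
      · nlinarith [sq_nonneg (a u₁ - b₁ u₁), sq_nonneg (b u₁ + a₁ u₁)]
    have k2 : |a u₁ * a₁ u₁ + b u₁ * b₁ u₁| ≤ (s u₁ + w2 u₁) / 2 := by
      rw [abs_le]; simp only [hsdef, hw2def]
      constructor
      · nlinarith [sq_nonneg (a u₁ + a₁ u₁), sq_nonneg (b u₁ + b₁ u₁)]
      · nlinarith [sq_nonneg (a u₁ - a₁ u₁), sq_nonneg (b u₁ - b₁ u₁)]
    have m1 := mul_le_mul_of_nonneg_left k1 hEu
    have m2 := mul_le_mul_of_nonneg_left k2 hEu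
    simp only [hGdef]
    nlinarith [m1, m2]
  -- `(q − p)·G(u₁) ≤ ∫_L G = ∫_L E u s + ∫_L E u w2`
  have hGi : IntervalIntegrable G volume p q := hGc.intervalIntegrable_of_Icc hpq
  have hGsplit : ∫ u in p..q, G u = (∫ u in p..q, E u * (u * s u)) + ∫ u in p..q, E u * (u * w2 u) := by
    rw [← intervalIntegral.integral_add]
    · congr 1; funext u; simp only [hGdef]; ring
    · exact (((hEc.mono hsubL).mul (continuousOn_id.mul (hsc.mono hsubL))).intervalIntegrable_of_Icc hpq)
    · exact (((hEc.mono hsubL).mul (continuousOn_id.mul (hw2c.mono hsubL))).intervalIntegrable_of_Icc hpq)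
  -- layer dissipation on `L'` with `χ = (u − u₀)(r − u)`
  have hu₀r' : u₀ < r := by rw [hrdef]; linarith [show 0 < 3 / γ by positivity]
  have hLD := layer_dissipation_le (m := m) (V := V) hu₀ hu₀r' ha hb ha₁ hb₁ hf₁ hf₂ hdera hderb hΦa hΦb
  -- compare `∫_L E u w2 ≤ γ⁴ ∫_{L'} E χ² u w2` (χ² ≥ γ⁻⁴ on L)
  have hcontχw : ContinuousOn (fun u => E u * ((u - u₀) * (r - u)) ^ 2 * (u * w2 u)) (Icc u₀ r) :=
    (hEc.mul (((continuousOn_id.sub continuousOn_const).mul (continuousOn_const.sub continuousOn_id)).pow 2)).mul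
      (continuousOn_id.mul hw2c)
  have hIχw : IntervalIntegrable (fun u => E u * ((u - u₀) * (r - u)) ^ 2 * (u * w2 u)) volume u₀ r :=
    hcontχw.intervalIntegrable_of_Icc hu₀r
  have h1 : ∫ u in p..q, E u * (u * w2 u) ≤ γ ^ 4 * ∫ u in u₀..r, E u * ((u - u₀) * (r - u)) ^ 2 * (u * w2 u) := by
    have hA : ∫ u in p..q, E u * (u * w2 u) ≤ ∫ u in p..q, γ ^ 4 * (E u * ((u - u₀) * (r - u)) ^ 2 * (u * w2 u)) := by
      apply integral_mono_on hpq
      · exact ((hEc.mono hsubL).mul (continuousOn_id.mul (hw2c.mono hsubL))).intervalIntegrable_of_Icc hpq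
      · exact ((hIχw.mono_set (by rw [uIcc_of_le hpq, uIcc_of_le hu₀r]; exact hsubL)).const_mul _)
      · intro u hu
        have hu1 : p ≤ u := hu.1
        have hu2 : u ≤ q := hu.2
        rw [hpdef] at hu1
        rw [hqdef] at hu2
        have hup : 1 / γ ≤ u - u₀ := by linarith
        have huq : 1 / γ ≤ r - u := by rw [hrdef]; linarith
        have hχ : 1 / γ ^ 2 ≤ (u - u₀) * (r - u) := by
          have := mul_le_mul hup huq hℓ.le (by linarith)
          rw [show 1 / γ * (1 / γ) = 1 / γ ^ 2 by ring] at this; exact this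
        have hχ2 : 1 / γ ^ 4 ≤ ((u - u₀) * (r - u)) ^ 2 := by
          have := pow_le_pow_left₀ (by positivity) hχ 2
          rw [show (1 / γ ^ 2) ^ 2 = 1 / γ ^ 4 by ring] at this; exact this
        have hX : 0 ≤ E u * (u * w2 u) := by
          have : 0 < u := lt_of_lt_of_le hp0 hu.1
          simp only [hw2def]; positivity
        have e : γ ^ 4 * (E u * ((u - u₀) * (r - u)) ^ 2 * (u * w2 u)) = (γ ^ 4 * ((u - u₀) * (r - u)) ^ 2) * (E u * (u * w2 u)) := by
          ring
        rw [e]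
        have h1' : 1 ≤ γ ^ 4 * ((u - u₀) * (r - u)) ^ 2 := by
          have := mul_le_mul_of_nonneg_left hχ2 (show 0 ≤ γ ^ 4 by positivity)
          rwa [show γ ^ 4 * (1 / γ ^ 4) = 1 by field_simp] at this
        nlinarith
    have hB : ∫ u in p..q, γ ^ 4 * (E u * ((u - u₀) * (r - u)) ^ 2 * (u * w2 u))
        ≤ γ ^ 4 * ∫ u in u₀..r, E u * ((u - u₀) * (r - u)) ^ 2 * (u * w2 u) := by
      rw [intervalIntegral.integral_const_mul]
      apply mul_le_mul_of_nonneg_left _ (by positivity)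
      apply integral_mono_interval hu₀p hpq hqr _ hIχw
      refine MeasureTheory.ae_restrict_of_forall_mem measurableSet_Ioc (fun u hu => ?_)
      have : 0 < u := lt_trans hu₀ hu.1
      simp only [hw2def]; positivity
    exact hA.trans hB
  -- bound the χ²- and χ′²-weighted `s`-integrals on `L'` by plain ones (`χ² ≤ 81/(16γ⁴)`, `χ′² ≤ 9/γ²`)
  have hIEs : IntervalIntegrable (fun u => E u * s u) volume u₀ r := (hEc.mul hsc).intervalIntegrable_of_Icc hu₀r
  have hIEus : IntervalIntegrable (fun u => E u * (u * s u)) volume u₀ r :=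
    (hEc.mul (continuousOn_id.mul hsc)).intervalIntegrable_of_Icc hu₀r
  have hIEf : IntervalIntegrable (fun u => E u * |a u * f₁ u + b u * f₂ u|) volume u₀ r :=
    (hEc.mul ((ha.mul hf₁).add (hb.mul hf₂)).abs).intervalIntegrable_of_Icc hu₀r
  have hχbd : ∀ u ∈ Icc u₀ r, ((u - u₀) * (r - u)) ^ 2 ≤ 81 / (16 * γ ^ 4) ∧ (u₀ + r - 2 * u) ^ 2 ≤ 9 / γ ^ 2 := by
    intro u hu
    have hr' : r - u₀ = 3 / γ := by rw [hrdef]; ring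
    constructor
    · have h0 : (u - u₀) * (r - u) ≤ ((r - u₀) / 2) ^ 2 := by nlinarith [sq_nonneg (u - u₀ - (r - u))]
      have h0' : 0 ≤ (u - u₀) * (r - u) := mul_nonneg (by linarith [hu.1]) (by linarith [hu.2])
      have := pow_le_pow_left₀ h0' h0 2
      rw [hr'] at this
      calc ((u - u₀) * (r - u)) ^ 2 ≤ ((3 / γ / 2) ^ 2) ^ 2 := this
        _ = 81 / (16 * γ ^ 4) := by field_simp; ring
    · have : |u₀ + r - 2 * u| ≤ 3 / γ := by
        rw [abs_le]; constructor <;> linarith [hu.1, hu.2]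
      have := pow_le_pow_left₀ (abs_nonneg _) this 2
      rw [sq_abs] at this
      calc (u₀ + r - 2 * u) ^ 2 ≤ (3 / γ) ^ 2 := this
        _ = 9 / γ ^ 2 := by field_simp; ring
  have hIχs : IntervalIntegrable (fun u => E u * ((u - u₀) * (r - u)) ^ 2 * (a u ^ 2 + b u ^ 2)) volume u₀ r :=
    ((hEc.mul (((continuousOn_id.sub continuousOn_const).mul (continuousOn_const.sub continuousOn_id)).pow 2)).mul
      hsc).intervalIntegrable_of_Icc hu₀r
  have hIχf : IntervalIntegrable (fun u => E u * ((u - u₀) * (r - u)) ^ 2 * |a u * f₁ u + b u * f₂ u|) volume u₀ r :=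
    ((hEc.mul (((continuousOn_id.sub continuousOn_const).mul (continuousOn_const.sub continuousOn_id)).pow 2)).mul
      ((ha.mul hf₁).add (hb.mul hf₂)).abs).intervalIntegrable_of_Icc hu₀r
  have hIχ's : IntervalIntegrable (fun u => E u * (u₀ + r - 2 * u) ^ 2 * (u * (a u ^ 2 + b u ^ 2))) volume u₀ r :=
    ((hEc.mul ((continuousOn_const.sub (continuousOn_const.mul continuousOn_id)).pow 2)).mul
      (continuousOn_id.mul hsc)).intervalIntegrable_of_Icc hu₀r
  have h2 : ∫ u in u₀..r, E u * ((u - u₀) * (r - u)) ^ 2 * (a u ^ 2 + b u ^ 2) ≤ 81 / (16 * γ ^ 4) * ∫ u in u₀..r, E u * s u := by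
    rw [← intervalIntegral.integral_const_mul]
    refine integral_mono_on hu₀r hIχs (hIEs.const_mul _) (fun u hu => ?_)
    have := (hχbd u hu).1
    have hX : 0 ≤ E u * s u := by simp only [hsdef]; positivity
    simp only [hsdef] at hX ⊢
    nlinarith
  have h3 : ∫ u in u₀..r, E u * ((u - u₀) * (r - u)) ^ 2 * |a u * f₁ u + b u * f₂ u|
      ≤ 81 / (16 * γ ^ 4) * ∫ u in u₀..r, E u * |a u * f₁ u + b u * f₂ u| := by
    rw [← intervalIntegral.integral_const_mul]
    refine integral_mono_on hu₀r hIχf (hIEf.const_mul _) (fun u hu => ?_)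
    have := (hχbd u hu).1
    have hX : 0 ≤ E u * |a u * f₁ u + b u * f₂ u| := by positivity
    nlinarith
  have h4 : ∫ u in u₀..r, E u * (u₀ + r - 2 * u) ^ 2 * (u * (a u ^ 2 + b u ^ 2)) ≤ 9 / γ ^ 2 * ∫ u in u₀..r, E u * (u * s u) := by
    rw [← intervalIntegral.integral_const_mul]
    refine integral_mono_on hu₀r hIχ's (hIEus.const_mul _) (fun u hu => ?_)
    have := (hχbd u hu).2
    have hu' : 0 < u := lt_of_lt_of_le hu₀ hu.1
    have hX : 0 ≤ E u * (u * s u) := by simp only [hsdef]; positivity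
    simp only [hsdef] at hX ⊢
    nlinarith
  -- nonnegativity of the plain integrals
  have hIEus0 : 0 ≤ ∫ u in u₀..r, E u * (u * s u) :=
    integral_nonneg hu₀r (fun u hu => by have : 0 < u := lt_of_lt_of_le hu₀ hu.1; simp only [hsdef]; positivity)
  have hLus : ∫ u in p..q, E u * (u * s u) ≤ ∫ u in u₀..r, E u * (u * s u) := by
    apply integral_mono_interval hu₀p hpq hqr _ hIEus
    refine MeasureTheory.ae_restrict_of_forall_mem measurableSet_Ioc (fun u hu => ?_)
    have : 0 < u := lt_trans hu₀ hu.1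
    simp only [hsdef]; positivity
  -- assemble: `(1/γ)·G(u₁) ≤ ∫_L G`
  rw [hpq'] at hGu₁
  have hG' : G u₁ ≤ γ * ((∫ u in p..q, E u * (u * s u)) + ∫ u in p..q, E u * (u * w2 u)) := by
    rw [← hGsplit]
    have := hGu₁
    rw [div_mul_eq_mul_div, one_mul, div_le_iff₀ hγ] at this
    linarith [mul_comm (∫ u in p..q, G u) γ]
  -- the dissipation part: `∫_L E u w2 ≤ (81γ/32) I_s + (81/32) I_f + 36γ² I_us`
  have hLD' : ∫ u in u₀..r, E u * ((u - u₀) * (r - u)) ^ 2 * (u * w2 u)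
      ≤ γ / 2 * (81 / (16 * γ ^ 4) * ∫ u in u₀..r, E u * s u)
        + 1 / 2 * (81 / (16 * γ ^ 4) * ∫ u in u₀..r, E u * |a u * f₁ u + b u * f₂ u|)
        + 4 * (9 / γ ^ 2 * ∫ u in u₀..r, E u * (u * s u)) := by
    have h0 := hLD
    simp only [hEdef, hw2def, hsdef] at h0 h2 h3 h4 ⊢
    have h2' := mul_le_mul_of_nonneg_left h2 (show 0 ≤ γ / 2 by positivity)
    have h3' := mul_le_mul_of_nonneg_left h3 (show (0:ℝ) ≤ 1 / 2 by norm_num)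
    have h4' := mul_le_mul_of_nonneg_left h4 (show (0:ℝ) ≤ 4 by norm_num)
    linarith
  have hdis : ∫ u in p..q, E u * (u * w2 u)
      ≤ 81 * γ / 32 * (∫ u in u₀..r, E u * s u) + 81 / 32 * (∫ u in u₀..r, E u * |a u * f₁ u + b u * f₂ u|)
        + 36 * γ ^ 2 * (∫ u in u₀..r, E u * (u * s u)) := by
    have h5 := h1.trans (mul_le_mul_of_nonneg_left hLD' (by positivity))
    have e : γ ^ 4 * (γ / 2 * (81 / (16 * γ ^ 4) * ∫ u in u₀..r, E u * s u)
        + 1 / 2 * (81 / (16 * γ ^ 4) * ∫ u in u₀..r, E u * |a u * f₁ u + b u * f₂ u|)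
        + 4 * (9 / γ ^ 2 * ∫ u in u₀..r, E u * (u * s u)))
        = 81 * γ / 32 * (∫ u in u₀..r, E u * s u) + 81 / 32 * (∫ u in u₀..r, E u * |a u * f₁ u + b u * f₂ u|)
          + 36 * γ ^ 2 * (∫ u in u₀..r, E u * (u * s u)) := by
      field_simp
      ring
    linarith [h5, e]
  have hmain : 4 * G u₁ ≤ 4 * γ * ((1 + 36 * γ ^ 2) * (∫ u in u₀..r, E u * (u * s u))
      + 81 * γ / 32 * (∫ u in u₀..r, E u * s u) + 81 / 32 * (∫ u in u₀..r, E u * |a u * f₁ u + b u * f₂ u|)) := by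
    have h6 : (∫ u in p..q, E u * (u * s u)) + ∫ u in p..q, E u * (u * w2 u)
        ≤ (1 + 36 * γ ^ 2) * (∫ u in u₀..r, E u * (u * s u))
          + 81 * γ / 32 * (∫ u in u₀..r, E u * s u) + 81 / 32 * (∫ u in u₀..r, E u * |a u * f₁ u + b u * f₂ u|) := by
      linarith [hdis, hLus]
    have h7 := mul_le_mul_of_nonneg_left h6 hγ.le
    linarith [hG', h7]
  have hfin := hflux.trans hmain
  simpa [hEdef, hsdef, hrdef] using hfin

end Summit.NavierStokesRegularity.NavierStokesRegularity.Theorems.DefectColumnGate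

end
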